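import Summits.CriticalPhenomena.CardyFormulaZ2.Theorems.CardyMagicRigidityNestingRigidityExteriorConditioning
import Summits.CriticalPhenomena.CardyFormulaZ2.Theorems.CardyMagicRigidityNestingRigidityNeckCoarseStructure
import Summits.CriticalPhenomena.CardyFormulaZ2.Theorems.CardyMagicRigidityNestingRigidityNeckCoarseZ2Reduction
import HarnessLib

/-!
# Identification at one cell: the hook-up frequency in an exterior context is the integral of the coarse function

Crux `Summit.CriticalPhenomena.CardyFormulaZ2.Theses.CardyMagicRigidity.NestingRigidity` (stmt-CriticalPhenomena-4835),
line `pinch-resampling` v4, stub S10' `stub_neckTomographyV4` (`FiveArmUpperT → FiveArmUpperZ2 → NoNeckRigidity →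
NeckHookupCoarseT → NeckHookupCoarseZ2 → LoopLimitZ2Blind → LoopLimitZ2EqT`).  Typing note `S10p-typing-v2.md`, item A7
(identification), single lattice `𝕋`, one cell: this is exactly how the transfer CONSUMES the coarse-measurability
stub S11 (`NeckHookupCoarseT`, `…PinchResamplingDefsV4`).

* §1 `Tomography.measurable_of_finite_determined`: a real function of a site configuration reading only finitely many
  sites is measurable (every preimage is a finitely determined event); hence `g^𝕋 = tHookProb x s` and every
  `G ∘ tCoarse` are measurable (both read only the collar `Λ_{2s}(x) ∖ Λ_s(x)`, `tHookProb_congr`, `tCoarse_congr`).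
* §2 **`abs_real_tPinch_inter_tHook_sub_integral_le` (registered anchor)**: for a coarse function `G` with values in
  `[0, 1]` (the consumer clamps) whose deviation event `TPinch ∩ {b < |g − G ∘ tCoarse|}` has probability
  `≤ b · P(TPinch)` (the conclusion of `NeckHookupCoarseT` at the scale in hand), and for every EXTERIOR CONTEXT event `F`
  of the ball `Λ_s(x)` (measurable, `DeterminedBy F (Λ_s(x))ᶜ` — in the transfer: pinned unambiguity
  `tUnambiguousIf_determinedBy`, a coarse value `{tCoarse = σ}`, selection elsewhere, robust hulls),
  `|P(TPinch ∩ F ∩ THook) − ∫_{TPinch ∩ F} G ∘ tCoarse dP| ≤ 2b · P(TPinch)`.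
  Proof: `P(THook ∩ (TPinch ∩ F)) = ∫_{TPinch ∩ F} g dP` is the splice identity `real_tHook_inter_eq_integral_splice`
  (p151755; `TPinch ∩ F` is an exterior event), and on `TPinch` pointwise `|g − G ∘ tCoarse| ≤ b + 1_{deviation}`
  (`g, G ∈ [0,1]`).  Summed over the cells and coarse values of a window and compared across the blind coupling (where
  selection, coarse data and pinned unambiguity agree on the good event, D1), this gives the identification
  `Σ_σ |P_𝕋(σ, unamb, Hook) − P_{ℤ²}(σ, unamb, Hook)| → 0` of the assembly.

* §3 the `ℤ²` twin **`abs_real_zFourStrands_inter_zHookR_sub_integral_le`** (second registered anchor): the same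
  inequality for critical bond percolation, selection `ZFourStrands x s`, hook-up `ZHookR x s`, `g = zHookProb x s`, coarse
  datum `zCoarse`, exterior events determined by the pairs `zExtEdges x s` (splice identity `real_zHookR_inter_eq_integral`
  and `measurable_zHookProb` of S12's `…NeckCoarseZ2Reduction`) — this is how the transfer consumes S12.

Sorry-free; no `Prop` definition is introduced.
-/

noncomputable section

namespace Summit.CriticalPhenomena.CardyFormulaZ2.Cruxes.NestingRigidity.PinchResampling

open Summit.CriticalPhenomena.CardyFormulaZ2.Theses.CardyMagicRigidity
open MeasureTheory Set Literature.Probability.Percolation Literature.Probability.LatticeModels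
  Literature.Probability.RandomPlanarGeometry

/-! ## §1 Functions reading finitely many sites are measurable -/

section Measurable

/-- **A real function of a site configuration that reads only the sites of a finite set `S` is measurable**: each of
its preimages is an event determined by `S` (`measurableSet_of_determinedBy_finite`). -/
theorem Tomography.measurable_of_finite_determined {S : Set (Site 2)} (hS : S.Finite) {f : SiteConfig (Site 2) → ℝ}
    (hf : ∀ ω ω' : SiteConfig (Site 2), ω ∩ S = ω' ∩ S → f ω = f ω') : Measurable f := by
  intro B _
  refine measurableSet_of_determinedBy_finite hS ?_
  rw [determinedBy_iff]
  intro ω ω' h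
  simp only [mem_preimage, hf ω ω' h]

/-- The collar `Λ_{2s}(x) ∖ Λ_s(x)` is finite. -/
theorem Tomography.collar_finite (x : Site 2) (s : ℕ) : (tBall x (2 * s) \ tBall x s).Finite :=
  (tBall_finite x (2 * s)).subset Set.sdiff_subset

/-- `g^𝕋_{x,s} = tHookProb x s` is measurable (it reads only the collar). -/
theorem Tomography.measurable_tHookProb (x : Site 2) (s : ℕ) : Measurable (tHookProb x s) :=
  Tomography.measurable_of_finite_determined (Tomography.collar_finite x s) fun _ _ h ↦ tHookProb_congr x s h

/-- Every function of the coarse datum, `G ∘ tCoarse`, is measurable (the datum reads only the collar). -/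
theorem Tomography.measurable_comp_tCoarse (ℓ lam s : ℕ) (x o : Site 2) (G : Set (Set (Site 2)) × Set (Set (Site 2)) → ℝ) :
    Measurable fun ω ↦ G (tCoarse ℓ lam s x o ω) :=
  Tomography.measurable_of_finite_determined (Tomography.collar_finite x s) fun _ _ h ↦ by simp only [tCoarse_congr ℓ lam s x o h]

end Measurable

/-! ## §2 Identification at one cell -/

section Identification

/-- The selection event is an exterior event of the ball `Λ_s(x)`. -/
theorem Tomography.tPinch_determinedBy_compl (x : Site 2) (s : ℕ) : DeterminedBy (TPinch x x s s) (tBall x s)ᶜ :=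
  (tPinch_determinedBy x x s s).mono fun _ hv ↦ hv.2

/-- `g^𝕋` takes values in `[0, 1]`. -/
theorem Tomography.tHookProb_mem_Icc (x : Site 2) (s : ℕ) (ω : SiteConfig (Site 2)) : tHookProb x s ω ∈ Icc (0 : ℝ) 1 :=
  condProbOff_mem_Icc _ _ _ _

/-- **Registered anchor — identification at one cell.**  Let `G` be a coarse function with values in `[0,1]` whose
deviation event on the selection event has probability `≤ b · P(TPinch x x s s)` (the conclusion of `NeckHookupCoarseT`
at this `(x, o, ℓ, lam, s)`), and let `F` be an exterior context event of `Λ_s(x)` (measurable, determined off the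
ball).  Then `|P(TPinch ∩ F ∩ THook) − ∫_{TPinch ∩ F} G ∘ tCoarse dP| ≤ 2b · P(TPinch)`. -/
theorem abs_real_tPinch_inter_tHook_sub_integral_le : ∀ (x o : Site 2) (s ℓ lam : ℕ) {b : ℝ}, 0 ≤ b → ∀ (G : Set (Set (Site 2)) × Set (Set (Site 2)) → ℝ), (∀ σ, G σ ∈ Set.Icc (0 : ℝ) 1) → (triSitePercolation half).real (TPinch x x s s ∩ {ω | b < |tHookProb x s ω - G (tCoarse ℓ lam s x o ω)|}) ≤ b * (triSitePercolation half).real (TPinch x x s s) → ∀ {F : Set (SiteConfig (Site 2))}, MeasurableSet F → DeterminedBy F (tBall x s)ᶜ → |(triSitePercolation half).real (TPinch x x s s ∩ F ∩ THook x x s s) - ∫ ω, (TPinch x x s s ∩ F).indicator (fun ω ↦ G (tCoarse ℓ lam s x o ω)) ω ∂(triSitePercolation half)| ≤ 2 * b * (triSitePercolation half).real (TPinch x x s s) := by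
  intro x o s ℓ lam b hb G hG hdev F hFm hF
  set P := triSitePercolation half with hP
  set A : Set (SiteConfig (Site 2)) := TPinch x x s s ∩ F with hA
  set g : SiteConfig (Site 2) → ℝ := tHookProb x s with hg
  set Gσ : SiteConfig (Site 2) → ℝ := fun ω ↦ G (tCoarse ℓ lam s x o ω) with hGσ
  set Bad : Set (SiteConfig (Site 2)) := TPinch x x s s ∩ {ω | b < |tHookProb x s ω - G (tCoarse ℓ lam s x o ω)|}
    with hBad
  have hAm : MeasurableSet A := (measurableSet_tPinch x x s s).inter hFm
  have hAd : DeterminedBy A (tBall x s)ᶜ := (Tomography.tPinch_determinedBy_compl x s).inter hF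
  have hTm : MeasurableSet (TPinch x x s s) := measurableSet_tPinch x x s s
  have hBadm : MeasurableSet Bad := measurableSet_neckBad b ℓ lam s x o G
  have hgm : Measurable g := Tomography.measurable_tHookProb x s
  have hGm : Measurable Gσ := Tomography.measurable_comp_tCoarse ℓ lam s x o G
  -- the splice identity: `P(THook ∩ A) = ∫ 1_A g`
  have hsplice : P.real (TPinch x x s s ∩ F ∩ THook x x s s) = ∫ ω, A.indicator g ω ∂P := by
    rw [inter_comm, hP, real_tHook_inter_eq_integral_splice x s hAm hAd]
    refine integral_congr_ae (Filter.Eventually.of_forall fun ω ↦ ?_)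
    by_cases hω : ω ∈ A
    · simp [indicator_of_mem hω, hg, tHookProb, condProbOff]
    · simp [indicator_of_notMem hω]
  -- pointwise bound on `TPinch`: `|g − Gσ| ≤ b + 1_Bad`
  have hpt : ∀ ω, |A.indicator g ω - A.indicator Gσ ω| ≤
      b * (TPinch x x s s).indicator 1 ω + Bad.indicator 1 ω := by
    intro ω
    by_cases hω : ω ∈ A
    · have hT : ω ∈ TPinch x x s s := hω.1
      simp only [indicator_of_mem hω, indicator_of_mem hT, Pi.one_apply, mul_one]
      by_cases hωB : ω ∈ Bad
      · simp only [indicator_of_mem hωB, Pi.one_apply]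
        have h1 := Tomography.tHookProb_mem_Icc x s ω
        have h2 := hG (tCoarse ℓ lam s x o ω)
        have : |g ω - Gσ ω| ≤ 1 := by
          rw [abs_sub_le_iff]; constructor <;> simp only [hg, hGσ] <;> linarith [h1.1, h1.2, h2.1, h2.2]
        linarith
      · simp only [indicator_of_notMem hωB, add_zero]
        have : ¬ b < |g ω - Gσ ω| := fun h ↦ hωB ⟨hT, h⟩
        linarith
    · simp only [indicator_of_notMem hω, sub_zero, abs_zero]
      exact add_nonneg (mul_nonneg hb (indicator_nonneg (fun _ _ ↦ zero_le_one) _))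
        (indicator_nonneg (fun _ _ ↦ zero_le_one) _)
  -- integrability of everything in sight (bounded measurable functions on a probability space)
  have hbound : ∀ {f : SiteConfig (Site 2) → ℝ}, Measurable f → (∀ ω, |f ω| ≤ 1) → Integrable f P := fun hf h1 ↦
    (integrable_const (1 : ℝ)).mono' hf.aestronglyMeasurable (Filter.Eventually.of_forall fun ω ↦ by
      simpa [Real.norm_eq_abs] using h1 ω)
  have hg1 : ∀ ω, |A.indicator g ω| ≤ 1 := fun ω ↦ by
    by_cases hω : ω ∈ A
    · simp only [indicator_of_mem hω]
      have h1 := Tomography.tHookProb_mem_Icc x s ω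
      rw [abs_le]; constructor <;> simp only [hg] <;> linarith [h1.1, h1.2]
    · simp [indicator_of_notMem hω]
  have hG1 : ∀ ω, |A.indicator Gσ ω| ≤ 1 := fun ω ↦ by
    by_cases hω : ω ∈ A
    · simp only [indicator_of_mem hω]
      have h2 := hG (tCoarse ℓ lam s x o ω)
      rw [abs_le]; constructor <;> simp only [hGσ] <;> linarith [h2.1, h2.2]
    · simp [indicator_of_notMem hω]
  have hIg : Integrable (A.indicator g) P := hbound (hgm.indicator hAm) hg1
  have hIG : Integrable (A.indicator Gσ) P := hbound (hGm.indicator hAm) hG1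
  have hI1 : Integrable ((TPinch x x s s).indicator (1 : SiteConfig (Site 2) → ℝ)) P :=
    (integrable_const (1 : ℝ)).indicator hTm
  have hI2 : Integrable (Bad.indicator (1 : SiteConfig (Site 2) → ℝ)) P := (integrable_const (1 : ℝ)).indicator hBadm
  -- assemble
  calc |P.real (TPinch x x s s ∩ F ∩ THook x x s s) - ∫ ω, A.indicator Gσ ω ∂P|
      = |∫ ω, (A.indicator g ω - A.indicator Gσ ω) ∂P| := by rw [hsplice, integral_sub hIg hIG]
    _ ≤ ∫ ω, |A.indicator g ω - A.indicator Gσ ω| ∂P := by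
        simpa [Real.norm_eq_abs] using norm_integral_le_integral_norm (μ := P) fun ω ↦ A.indicator g ω - A.indicator Gσ ω
    _ ≤ ∫ ω, (b * (TPinch x x s s).indicator 1 ω + Bad.indicator 1 ω) ∂P := by
        refine integral_mono (hIg.sub hIG).abs ((hI1.const_mul b).add hI2) fun ω ↦ hpt ω
    _ = b * P.real (TPinch x x s s) + P.real Bad := by
        rw [integral_add (hI1.const_mul b) hI2, integral_const_mul, integral_indicator_one hTm,
          integral_indicator_one hBadm]
    _ ≤ b * P.real (TPinch x x s s) + b * P.real (TPinch x x s s) := by gcongr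
    _ = 2 * b * P.real (TPinch x x s s) := by ring

end Identification

/-! ## §3 The `ℤ²` twin: identification at one cell for critical bond percolation -/

section IdentificationZ2

/-- A real function of a configuration over any index type that reads only finitely many coordinates is measurable. -/
theorem Tomography.measurable_of_finite_determined' {ι : Type*} {S : Set ι} (hS : S.Finite) {f : Set ι → ℝ}
    (hf : ∀ ω ω' : Set ι, ω ∩ S = ω' ∩ S → f ω = f ω') : Measurable f := by
  intro B _
  refine measurableSet_of_determinedBy_finite hS ?_
  rw [determinedBy_iff]
  intro ω ω' h
  simp only [mem_preimage, hf ω ω' h]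

/-- Every function of the `ℤ²` coarse datum, `G ∘ zCoarse`, is measurable (the datum reads only the collar pairs). -/
theorem Tomography.measurable_comp_zCoarse (ℓ lam s : ℕ) (x o : Site 2) (G : Set (Set (Site 2)) × Set (Set (Site 2)) → ℝ) :
    Measurable fun ω ↦ G (zCoarse ℓ lam s x o ω) :=
  Tomography.measurable_of_finite_determined'
    (finite_sym2 ((zBall_finite x (2 * s)).subset (Set.sdiff_subset : zBall x (2 * s) \ zBall x s ⊆ _)))
    fun _ _ h ↦ by simp only [zCoarse_congr h]

/-- `g^{ℤ²}` takes values in `[0, 1]`. -/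
theorem Tomography.zHookProb_mem_Icc (x : Site 2) (s : ℕ) (ω : BondConfig (Site 2)) : zHookProb x s ω ∈ Icc (0 : ℝ) 1 :=
  condProbOff_mem_Icc _ _ _ _

/-- **Second registered anchor — identification at one cell on `ℤ²`.**  For a coarse function `G` with values in
`[0,1]` whose deviation event on `ZFourStrands x s` has probability `≤ b · P(ZFourStrands x s)` (the conclusion of
`NeckHookupCoarseZ2` at this scale) and an exterior context event `F` (measurable, determined by the pairs with no
endpoint in `Λ_s(x)`), `|P(ZFourStrands ∩ F ∩ ZHookR) − ∫_{ZFourStrands ∩ F} G ∘ zCoarse dP| ≤ 2b · P(ZFourStrands)`. -/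
theorem abs_real_zFourStrands_inter_zHookR_sub_integral_le : ∀ (x o : Site 2) (s ℓ lam : ℕ) {b : ℝ}, 0 ≤ b → ∀ (G : Set (Set (Site 2)) × Set (Set (Site 2)) → ℝ), (∀ σ, G σ ∈ Set.Icc (0 : ℝ) 1) → (bondPercolation (zdGraph 2) half).real (ZFourStrands x s ∩ {ω | b < |zHookProb x s ω - G (zCoarse ℓ lam s x o ω)|}) ≤ b * (bondPercolation (zdGraph 2) half).real (ZFourStrands x s) → ∀ {F : Set (BondConfig (Site 2))}, MeasurableSet F → DeterminedBy F (zExtEdges x s) → |(bondPercolation (zdGraph 2) half).real (ZFourStrands x s ∩ F ∩ ZHookR x s) - ∫ ω, (ZFourStrands x s ∩ F).indicator (fun ω ↦ G (zCoarse ℓ lam s x o ω)) ω ∂(bondPercolation (zdGraph 2) half)| ≤ 2 * b * (bondPercolation (zdGraph 2) half).real (ZFourStrands x s) := by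
  intro x o s ℓ lam b hb G hG hdev F hFm hF
  set P := bondPercolation (zdGraph 2) half with hP
  set A : Set (BondConfig (Site 2)) := ZFourStrands x s ∩ F with hA
  set g : BondConfig (Site 2) → ℝ := zHookProb x s with hg
  set Gσ : BondConfig (Site 2) → ℝ := fun ω ↦ G (zCoarse ℓ lam s x o ω) with hGσ
  set Bad : Set (BondConfig (Site 2)) := ZFourStrands x s ∩ {ω | b < |zHookProb x s ω - G (zCoarse ℓ lam s x o ω)|}
    with hBad
  have hTm : MeasurableSet (ZFourStrands x s) := measurableSet_zFourStrands x s
  have hAm : MeasurableSet A := hTm.inter hFm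
  have hAd : DeterminedBy A (zExtEdges x s) := (zFourStrands_determinedBy x s).inter hF
  have hgm : Measurable g := measurable_zHookProb x s
  have hGm : Measurable Gσ := Tomography.measurable_comp_zCoarse ℓ lam s x o G
  have hBadm : MeasurableSet Bad := hTm.inter (measurableSet_lt measurable_const (hgm.sub hGm).abs)
  -- the splice identity: `P(ZHookR ∩ A) = ∫ 1_A g`
  have hsplice : P.real (ZFourStrands x s ∩ F ∩ ZHookR x s) = ∫ ω, A.indicator g ω ∂P := by
    rw [inter_comm, hP, real_zHookR_inter_eq_integral x s hAm hAd]
    refine integral_congr_ae (Filter.Eventually.of_forall fun ω ↦ ?_)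
    by_cases hω : ω ∈ A
    · simp [indicator_of_mem hω, hg]
    · simp [indicator_of_notMem hω]
  -- pointwise bound on `ZFourStrands`: `|g − Gσ| ≤ b + 1_Bad`
  have hpt : ∀ ω, |A.indicator g ω - A.indicator Gσ ω| ≤
      b * (ZFourStrands x s).indicator 1 ω + Bad.indicator 1 ω := by
    intro ω
    by_cases hω : ω ∈ A
    · have hT : ω ∈ ZFourStrands x s := hω.1
      simp only [indicator_of_mem hω, indicator_of_mem hT, Pi.one_apply, mul_one]
      by_cases hωB : ω ∈ Bad
      · simp only [indicator_of_mem hωB, Pi.one_apply]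
        have h1 := Tomography.zHookProb_mem_Icc x s ω
        have h2 := hG (zCoarse ℓ lam s x o ω)
        have : |g ω - Gσ ω| ≤ 1 := by
          rw [abs_sub_le_iff]; constructor <;> simp only [hg, hGσ] <;> linarith [h1.1, h1.2, h2.1, h2.2]
        linarith
      · simp only [indicator_of_notMem hωB, add_zero]
        have : ¬ b < |g ω - Gσ ω| := fun h ↦ hωB ⟨hT, h⟩
        linarith
    · simp only [indicator_of_notMem hω, sub_zero, abs_zero]
      exact add_nonneg (mul_nonneg hb (indicator_nonneg (fun _ _ ↦ zero_le_one) _))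
        (indicator_nonneg (fun _ _ ↦ zero_le_one) _)
  -- integrability (bounded measurable functions on a probability space)
  have hbound : ∀ {f : BondConfig (Site 2) → ℝ}, Measurable f → (∀ ω, |f ω| ≤ 1) → Integrable f P := fun hf h1 ↦
    (integrable_const (1 : ℝ)).mono' hf.aestronglyMeasurable (Filter.Eventually.of_forall fun ω ↦ by
      simpa [Real.norm_eq_abs] using h1 ω)
  have hg1 : ∀ ω, |A.indicator g ω| ≤ 1 := fun ω ↦ by
    by_cases hω : ω ∈ A
    · simp only [indicator_of_mem hω]
      have h1 := Tomography.zHookProb_mem_Icc x s ω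
      rw [abs_le]; constructor <;> simp only [hg] <;> linarith [h1.1, h1.2]
    · simp [indicator_of_notMem hω]
  have hG1 : ∀ ω, |A.indicator Gσ ω| ≤ 1 := fun ω ↦ by
    by_cases hω : ω ∈ A
    · simp only [indicator_of_mem hω]
      have h2 := hG (zCoarse ℓ lam s x o ω)
      rw [abs_le]; constructor <;> simp only [hGσ] <;> linarith [h2.1, h2.2]
    · simp [indicator_of_notMem hω]
  have hIg : Integrable (A.indicator g) P := hbound (hgm.indicator hAm) hg1
  have hIG : Integrable (A.indicator Gσ) P := hbound (hGm.indicator hAm) hG1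
  have hI1 : Integrable ((ZFourStrands x s).indicator (1 : BondConfig (Site 2) → ℝ)) P :=
    (integrable_const (1 : ℝ)).indicator hTm
  have hI2 : Integrable (Bad.indicator (1 : BondConfig (Site 2) → ℝ)) P := (integrable_const (1 : ℝ)).indicator hBadm
  -- assemble
  calc |P.real (ZFourStrands x s ∩ F ∩ ZHookR x s) - ∫ ω, A.indicator Gσ ω ∂P|
      = |∫ ω, (A.indicator g ω - A.indicator Gσ ω) ∂P| := by rw [hsplice, integral_sub hIg hIG]
    _ ≤ ∫ ω, |A.indicator g ω - A.indicator Gσ ω| ∂P := by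
        simpa [Real.norm_eq_abs] using norm_integral_le_integral_norm (μ := P) fun ω ↦ A.indicator g ω - A.indicator Gσ ω
    _ ≤ ∫ ω, (b * (ZFourStrands x s).indicator 1 ω + Bad.indicator 1 ω) ∂P := by
        refine integral_mono (hIg.sub hIG).abs ((hI1.const_mul b).add hI2) fun ω ↦ hpt ω
    _ = b * P.real (ZFourStrands x s) + P.real Bad := by
        rw [integral_add (hI1.const_mul b) hI2, integral_const_mul, integral_indicator_one hTm,
          integral_indicator_one hBadm]
    _ ≤ b * P.real (ZFourStrands x s) + b * P.real (ZFourStrands x s) := by gcongr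
    _ = 2 * b * P.real (ZFourStrands x s) := by ring

end IdentificationZ2

end Summit.CriticalPhenomena.CardyFormulaZ2.Cruxes.NestingRigidity.PinchResampling

end
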